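import Literature.Geometry.Symplectic.JHolomorphicMap
import Literature.Topology.FourManifolds.ComplexProjectiveSpace
import Mathlib.Analysis.Meromorphic.Order
import Mathlib.Geometry.Manifold.Instances.Sphere
import Mathlib.Topology.Homotopy.Basic
import HarnessLib

/-!
# Vocabulary of the glue of the bi-foliation (line `cross-cap-laurent`, crux `GromovRecognitionRelEnd`,
item stmt-SmoothPoincare4-11009, stub `stub_coreGlue`)

Hypothesis STRUCTURES (`structure … : Prop`) and one `ℤ`-valued count bundling the unbundled
clauses that the registered stubs and the six vendored Literature facts of this crux repeat
verbatim, so that the integration files (`…Glue*.lean`) can state the leaf lemmas of the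
open–closed argument readably. Each structure is equivalent (`_iff` lemmas below, by
`constructor <;> rintro ⟨…⟩ <;> exact ⟨…⟩`) to exactly the clause text used in
`Literature.Geometry.Symplectic.hls_localFoliation_embeddedSphere_trivialNormal`,
`…gromovCompactness_spheres_dichotomy`, `…adjunction_embedded_of_somewhereInjective_sphere`,
`…jSphere_wedgeCount_factorsThroughHomology` and the registered `stub_coreGlue`. Nothing here is a
named fact: all are predicates WITH parameters (data of a sphere / a coordinate) or plain data.

* `TwoChartSphere JX u v` — a `C^∞` `JX`-holomorphic sphere in two-chart form (`v z = u z⁻¹`);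
* `IsEmbeddedPair u v` — it is embedded;
* `IsNormalWitness N π u v` — trivial-normal-bundle witness: the image is the regular zero set of
  the submersion `π` on the open `N`;
* `IsGlued F u v` — `F : C(ℂℙ¹, X)` is the glued map of the pair;
* `IsLeafOf JX F₀ u v` — a LEAF of the family of `F₀`: embedded `JX`-sphere with a normal witness
  whose glued map is homotopic to `F₀`;
* `IsHolCoordinate JX T U` — a smooth `JX`-holomorphic function with non-vanishing differential on
  the open `U` (the wedge coordinates `T_H`, `T_V`);
* `wedgeCount T U u v : ℤ` — the registered intersection count of the pair with `{y ∈ U | T y = 0}`;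
* `pairImage u v` — the image `range u ∪ {v 0}` of the pair.
-/

noncomputable section

open scoped Manifold ContDiff Topology
open Set Function Literature.Topology.FourManifolds Literature.Topology.FourManifolds.ComplexProjectiveSpace
  Literature.Geometry.Symplectic

-- the prescribed namespace `Summit.<P>.<Sub>.…` duplicates `SmoothPoincare4` (P = Sub)
set_option linter.dupNamespace false

namespace Summit.SmoothPoincare4.SmoothPoincare4.Theorems.GromovRecognitionRelEnd.CrossCapLaurent

section Pairs

variable {X : Type} [TopologicalSpace X] [ChartedSpace (EuclideanSpace ℝ (Fin 4)) X]

/-- A `C^∞` `JX`-holomorphic sphere in TWO-CHART form: `u` on the affine chart, `v` on the chart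
at infinity, `v z = u z⁻¹` for `z ≠ 0` (the vocabulary of all the vendored facts of this crux).
[folklore] -/
@[folklore]
structure TwoChartSphere (JX : ∀ y : X, TangentSpace (𝓡 4) y →L[ℝ] TangentSpace (𝓡 4) y)
    (u v : ℂ → X) : Prop where
  /-- `u` is smooth -/
  smooth_u : ContMDiff 𝓘(ℝ, ℂ) (𝓡 4) ∞ u
  /-- `v` is smooth -/
  smooth_v : ContMDiff 𝓘(ℝ, ℂ) (𝓡 4) ∞ v
  /-- the two charts are related by `z ↦ z⁻¹` -/
  compat : ∀ z : ℂ, z ≠ 0 → v z = u z⁻¹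
  /-- `u` is `JX`-holomorphic -/
  hol_u : IsJHolomorphic (𝓡 4) JX u
  /-- `v` is `JX`-holomorphic -/
  hol_v : IsJHolomorphic (𝓡 4) JX v

/-- Unfolding `TwoChartSphere` into the clause text of the vendored facts. [folklore] -/
theorem helper_twoChartSphere_iff : ∀ (JX : ∀ y : X, TangentSpace (𝓡 4) y →L[ℝ] TangentSpace (𝓡 4) y)
    (u v : ℂ → X),
    TwoChartSphere JX u v ↔
      ContMDiff 𝓘(ℝ, ℂ) (𝓡 4) ∞ u ∧ ContMDiff 𝓘(ℝ, ℂ) (𝓡 4) ∞ v ∧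
        (∀ z : ℂ, z ≠ 0 → v z = u z⁻¹) ∧ IsJHolomorphic (𝓡 4) JX u ∧ IsJHolomorphic (𝓡 4) JX v :=
  fun _ _ _ =>
  ⟨fun h => ⟨h.1, h.2, h.3, h.4, h.5⟩, fun h => ⟨h.1, h.2.1, h.2.2.1, h.2.2.2.1, h.2.2.2.2⟩⟩

/-- The two-chart sphere `(u, v)` is EMBEDDED: `u` an injective immersion, `v` immersed at `0`,
and the point at infinity `v 0` off the affine image. [folklore] -/
@[folklore]
structure IsEmbeddedPair (u v : ℂ → X) : Prop where
  /-- `u` is injective -/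
  injective : Injective u
  /-- `u` is an immersion -/
  imm_u : ∀ z, Injective (mfderiv 𝓘(ℝ, ℂ) (𝓡 4) u z)
  /-- `v` is immersed at the point at infinity -/
  imm_v : Injective (mfderiv 𝓘(ℝ, ℂ) (𝓡 4) v 0)
  /-- the point at infinity is not on the affine image -/
  infty_notMem : v 0 ∉ range u

/-- Unfolding `IsEmbeddedPair` into the clause text of the vendored facts. [folklore] -/
theorem isEmbeddedPair_iff (u v : ℂ → X) :
    IsEmbeddedPair u v ↔
      Injective u ∧ (∀ z, Injective (mfderiv 𝓘(ℝ, ℂ) (𝓡 4) u z)) ∧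
        Injective (mfderiv 𝓘(ℝ, ℂ) (𝓡 4) v 0) ∧ v 0 ∉ range u :=
  ⟨fun h => ⟨h.1, h.2, h.3, h.4⟩, fun h => ⟨h.1, h.2.1, h.2.2.1, h.2.2.2⟩⟩

/-- TRIVIAL-NORMAL-BUNDLE WITNESS of the two-chart sphere `(u, v)`: an open `N` containing the
image and a smooth submersion `π` on `N` cutting the image out as `{π = 0}`. [folklore] -/
@[folklore]
structure IsNormalWitness (N : Set X) (π : X → ℂ) (u v : ℂ → X) : Prop where
  /-- `N` is open -/
  isOpen : IsOpen N
  /-- `N` contains the image -/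
  image_subset : range u ∪ {v 0} ⊆ N
  /-- `π` is smooth on `N` -/
  smooth : ContMDiffOn (𝓡 4) 𝓘(ℝ, ℂ) ∞ π N
  /-- `π` is a submersion on `N` -/
  submersive : ∀ y ∈ N, Surjective (mfderiv (𝓡 4) 𝓘(ℝ, ℂ) π y)
  /-- the image is the zero set -/
  zeroSet_eq : {y | y ∈ N ∧ π y = 0} = range u ∪ {v 0}

/-- Unfolding `IsNormalWitness` into the clause text of the vendored facts. [folklore] -/
theorem isNormalWitness_iff (N : Set X) (π : X → ℂ) (u v : ℂ → X) :
    IsNormalWitness N π u v ↔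
      IsOpen N ∧ range u ∪ {v 0} ⊆ N ∧ ContMDiffOn (𝓡 4) 𝓘(ℝ, ℂ) ∞ π N ∧
        (∀ y ∈ N, Surjective (mfderiv (𝓡 4) 𝓘(ℝ, ℂ) π y)) ∧
        {y | y ∈ N ∧ π y = 0} = range u ∪ {v 0} :=
  ⟨fun h => ⟨h.1, h.2, h.3, h.4, h.5⟩, fun h => ⟨h.1, h.2.1, h.2.2.1, h.2.2.2.1, h.2.2.2.2⟩⟩

omit [ChartedSpace (EuclideanSpace ℝ (Fin 4)) X] in
/-- `F : C(ℂℙ¹, X)` is the GLUED MAP of the two-chart pair `(u, v)`: `u` read in the affine chart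
`CoordNeZero 0`, `v` in the chart `CoordNeZero 1`. [folklore] -/
@[folklore]
structure IsGlued (F : C(ComplexProjectiveSpace 1, X)) (u v : ℂ → X) : Prop where
  /-- on the affine chart `F` is `u` -/
  chart_zero : ∀ p, CoordNeZero 0 p → F p = u (affineCoordComplex 0 p 0)
  /-- on the chart at infinity `F` is `v` -/
  chart_one : ∀ p, CoordNeZero 1 p → F p = v (affineCoordComplex 1 p 0)

omit [ChartedSpace (EuclideanSpace ℝ (Fin 4)) X] in
/-- Unfolding `IsGlued` into the clause text of the vendored facts. [folklore] -/
theorem isGlued_iff (F : C(ComplexProjectiveSpace 1, X)) (u v : ℂ → X) :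
    IsGlued F u v ↔
      (∀ p, CoordNeZero 0 p → F p = u (affineCoordComplex 0 p 0)) ∧
        (∀ p, CoordNeZero 1 p → F p = v (affineCoordComplex 1 p 0)) :=
  ⟨fun h => ⟨h.1, h.2⟩, fun h => ⟨h.1, h.2⟩⟩

/-- A LEAF of the family of `F₀`: an embedded `JX`-two-chart sphere with a trivial-normal-bundle
witness whose glued map is homotopic to `F₀` (the leaves of the Gromov–McDuff fibrations of the
wedge cap are exactly these, for `F₀` the glued map of a sphere at infinity). [folklore] -/
@[folklore]
structure IsLeafOf (JX : ∀ y : X, TangentSpace (𝓡 4) y →L[ℝ] TangentSpace (𝓡 4) y)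
    (F₀ : C(ComplexProjectiveSpace 1, X)) (u v : ℂ → X) : Prop where
  /-- it is a smooth `JX`-holomorphic two-chart sphere -/
  sphere : TwoChartSphere JX u v
  /-- it is embedded -/
  embedded : IsEmbeddedPair u v
  /-- it has a trivial-normal-bundle witness -/
  witness : ∃ (N : Set X) (π : X → ℂ), IsNormalWitness N π u v
  /-- its glued map is homotopic to `F₀` -/
  glued : ∃ F : C(ComplexProjectiveSpace 1, X), IsGlued F u v ∧ F.Homotopic F₀

/-- Unfolding `IsLeafOf`. [folklore] -/
theorem isLeafOf_iff (JX : ∀ y : X, TangentSpace (𝓡 4) y →L[ℝ] TangentSpace (𝓡 4) y)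
    (F₀ : C(ComplexProjectiveSpace 1, X)) (u v : ℂ → X) :
    IsLeafOf JX F₀ u v ↔
      TwoChartSphere JX u v ∧ IsEmbeddedPair u v ∧
        (∃ (N : Set X) (π : X → ℂ), IsNormalWitness N π u v) ∧
        ∃ F : C(ComplexProjectiveSpace 1, X), IsGlued F u v ∧ F.Homotopic F₀ :=
  ⟨fun h => ⟨h.1, h.2, h.3, h.4⟩, fun h => ⟨h.1, h.2.1, h.2.2.1, h.2.2.2⟩⟩

/-- A `JX`-HOLOMORPHIC COORDINATE: `T : X → ℂ` smooth on the open `U`, with complex-linear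
(`dT ∘ JX = i · dT`) non-vanishing differential there (the wedge coordinates `T_H`, `T_V`).
[folklore] -/
@[folklore]
structure IsHolCoordinate (JX : ∀ y : X, TangentSpace (𝓡 4) y →L[ℝ] TangentSpace (𝓡 4) y)
    (T : X → ℂ) (U : Set X) : Prop where
  /-- the domain is open -/
  isOpen : IsOpen U
  /-- `T` is smooth on the domain -/
  smooth : ContMDiffOn (𝓡 4) 𝓘(ℝ, ℂ) ∞ T U
  /-- `dT` is complex-linear for `JX` -/
  hol : ∀ y ∈ U, ∀ w : TangentSpace (𝓡 4) y, (show ℂ from mfderiv (𝓡 4) 𝓘(ℝ, ℂ) T y (JX y w)) =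
    Complex.I * (show ℂ from mfderiv (𝓡 4) 𝓘(ℝ, ℂ) T y w)
  /-- `dT` does not vanish on the domain -/
  mfderiv_ne_zero : ∀ y ∈ U, mfderiv (𝓡 4) 𝓘(ℝ, ℂ) T y ≠ 0

/-- Unfolding `IsHolCoordinate`. [folklore] -/
theorem isHolCoordinate_iff (JX : ∀ y : X, TangentSpace (𝓡 4) y →L[ℝ] TangentSpace (𝓡 4) y)
    (T : X → ℂ) (U : Set X) :
    IsHolCoordinate JX T U ↔
      IsOpen U ∧ ContMDiffOn (𝓡 4) 𝓘(ℝ, ℂ) ∞ T U ∧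
        (∀ y ∈ U, ∀ w : TangentSpace (𝓡 4) y, (show ℂ from mfderiv (𝓡 4) 𝓘(ℝ, ℂ) T y (JX y w)) =
          Complex.I * (show ℂ from mfderiv (𝓡 4) 𝓘(ℝ, ℂ) T y w)) ∧
        (∀ y ∈ U, mfderiv (𝓡 4) 𝓘(ℝ, ℂ) T y ≠ 0) :=
  ⟨fun h => ⟨h.1, h.2, h.3, h.4⟩, fun h => ⟨h.1, h.2.1, h.2.2.1, h.2.2.2⟩⟩

end Pairs

section Counts

variable {X : Type}

/-- The registered INTERSECTION COUNT of the two-chart pair `(u, v)` with `{y ∈ U | T y = 0}`: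
zeros of `T ∘ u` with multiplicity (meromorphic order), plus the order of `T ∘ v` at `0` if the
point at infinity lies in the zero set. [folklore] -/
def wedgeCount (T : X → ℂ) (U : Set X) (u v : ℂ → X) : ℤ :=
  (∑ᶠ z ∈ {z : ℂ | u z ∈ U ∧ T (u z) = 0}, (meromorphicOrderAt (T ∘ u) z).untop₀) +
    (∑ᶠ w ∈ {w : ℂ | w = 0 ∧ v w ∈ U ∧ T (v w) = 0}, (meromorphicOrderAt (T ∘ v) w).untop₀)

/-- Unfolding `wedgeCount` (the registered finsum expression). [folklore] -/
theorem wedgeCount_eq (T : X → ℂ) (U : Set X) (u v : ℂ → X) :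
    wedgeCount T U u v =
      (∑ᶠ z ∈ {z : ℂ | u z ∈ U ∧ T (u z) = 0}, (meromorphicOrderAt (T ∘ u) z).untop₀) +
        (∑ᶠ w ∈ {w : ℂ | w = 0 ∧ v w ∈ U ∧ T (v w) = 0}, (meromorphicOrderAt (T ∘ v) w).untop₀) :=
  rfl

/-- The IMAGE `range u ∪ {v 0}` of a two-chart pair. [folklore] -/
def pairImage (u v : ℂ → X) : Set X := range u ∪ {v 0}

/-- Unfolding `pairImage`. [folklore] -/
theorem pairImage_eq (u v : ℂ → X) : pairImage u v = range u ∪ {v 0} := rfl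

/-- Membership in the image of a two-chart pair. [folklore] -/
theorem mem_pairImage_iff (u v : ℂ → X) (y : X) :
    y ∈ pairImage u v ↔ (∃ z, u z = y) ∨ y = v 0 := by
  simp only [pairImage, Set.mem_union, Set.mem_range, Set.mem_singleton_iff]

end Counts

end Summit.SmoothPoincare4.SmoothPoincare4.Theorems.GromovRecognitionRelEnd.CrossCapLaurent

end
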